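import Literature.Analysis.FluidPDE.Ferrari1993PressureNeumannProblem
import Literature.Analysis.FluidPDE.Ferrari1993PressureProductEstimates
import HarnessLib

/-!
# Ferrari's Lemma 2 from the standard Neumann estimate: the reduction of
`Ferrari1993_periodicCylinderPressureEstimate`

Topic `Literature/Analysis/FluidPDE`. Support file (all results proved, no named facts, no
definitions). Third file of the decomposition of the named fact
`Literature.Analysis.FluidPDE.Ferrari1993_periodicCylinderPressureEstimate`
(`Ferrari1993EnergyInequalityReduction.lean`; A. B. Ferrari, Comm. Math. Phys. **155** (1993),
Lemma 2, pp. 280–281: for a solution of the Euler equations (1)–(3),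
`|∇p|_{H^s} ≤ C |u|_{W^{1,∞}} |u|_{H^s}`). The printed proof derives the Neumann problem (10)–(12)
for the pressure (proved: `Ferrari1993PressureNeumannProblem.lean`), bounds its data by Lemma 1 i)
(proved: `Ferrari1993PressureProductEstimates.lean`), and feeds both into "a standard estimate of
`∇p`", the `H^s` estimate for the Neumann problem combined with the Trace theorem (p. 281), the
boundary norm being defined through extensions (p. 278). This file **proves the assembly**
`Ferrari1993_periodicCylinderPressureEstimate_of_neumannEstimate`: the target follows from that
standard estimate, stated here — in Ferrari's own form, at `s = 3`, on the open period cell of the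
periodic cylinder, for functions smooth on the closed cylinder and `L`-periodic — as the
hypothesis

  `∀ L > 0, ∃ C, ∀ q G` (`C^∞` on `{r ≤ 1}`, `L`-periodic in `z`, `D q|_K (e_r) = G` on `{r = 1}`),
  `‖∇q‖_{H³(cell)} ≤ C (‖Δq‖_{H²(cell)} + ‖G‖_{H³(cell)})`.

The hypothesis is spelled out rather than vendored as a named fact (D-0026: this decomposition
introduces no new named facts); it is the remaining analytic input of Lemma 2 — `H⁴` regularity of
the Neumann problem up to the curved wall and the trace theorem, for which the tree's programme is
the a-priori estimate for smooth periodic functions on the cylinder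
(`PeriodicCylinderWithinCalculus.lean`, `PeriodicCylinderNeumannTangential.lean`: energy identity and
tangential regularity along the Killing fields `∂_θ`, `∂_z`; normal derivatives through the polar
identity `r²Δ_h = ∂_{x_h}² + ∂_θ²` and interior estimates to follow). Once it is a theorem `thm`,
`Ferrari1993_periodicCylinderPressureEstimate_holds := …_of_neumannEstimate thm`.

Proof of the assembly, for a solution `(u, p)` of the class `IsPeriodicCylinderEulerSolution L [0,T) u₀`
and `t ∈ [0, T)`: apply the hypothesis to `q = p(t)` and `G = u₀(t)² + u₁(t)²` (both `C^∞` on the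
closed cylinder and `L`-periodic; the Neumann relation is `neumann_pressure_eq`); on the cell
`Δp(t) = −tr(D_K u ∘ D_K u) = −Σᵢⱼ ℓⱼ(∂ᵢu) ℓᵢ(∂ⱼu)` (`laplacian_eq_cylLap`, `cylLap_pressure_eq`,
`trace_comp_self_eq_sum_coord` in the basis of the tree's Sobolev norm), so
`‖Δp(t)‖_{H²(cell)} ≤ Σᵢⱼ ‖ℓⱼ(∂ᵢu) ℓᵢ(∂ⱼu)‖_{H²} ≤ 9 C₁ ‖u‖_{W^{1,∞}} ‖u‖_{H³}`
(`exists_eSobolevDomainNorm_two_coord_fderivWithin_mul_le`) and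
`‖G‖_{H³(cell)} ≤ Σ_{k<2} ‖u_k²‖_{H³} ≤ 2 C₂ ‖u‖_{W^{1,∞}} ‖u‖_{H³}`
(`exists_eSobolevDomainNorm_three_coord_sq_le`); the constant is `C_N (9 C₁ + 2 C₂)`.

Mathlib/tree search: `lean search 'PressureEstimate_of|neumannEstimate'` — nothing besides the
consumers of the target (`Ferrari1993_periodicCylinderHsEnergyInequality_of_pressure`,
`Ferrari1993MoserInequality.lean`). Used: the two sibling files; `SobolevApprox.eSobolevDomainNorm_congr`,
`SobolevApprox.eSobolevDomainNorm_sum_le`, `eSobolevDomainNorm_clm_comp_le`; from Mathlib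
`ContinuousLinearMap.toLinearMap_comp`, `Finset.sum_pair`, `finrank_euclideanSpace_fin`.

## References

* A. B. Ferrari, *On the blow-up of solutions of the 3-D Euler equations in a bounded domain*,
  Comm. Math. Phys. 155 (1993) 277–294, Lemma 2 and its proof, pp. 280–281; p. 278. [Ferrari1993]
* R. Temam, *On the Euler equations of incompressible perfect fluids*, J. Funct. Anal. 20 (1975)
  32–43, §1. [Temam1975]
* M. E. Taylor, *Partial Differential Equations I*, 2nd ed. (2011), Ch. 5 §7 (7.37), Props. 7.5–7.7
  (the standard Neumann estimate on a compact manifold with boundary) and Ch. 4 §4 Prop. 4.5 (trace).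
  [TaylorPDEI2011]
-/

noncomputable section

open MeasureTheory Set Function Filter Topology TopologicalSpace WithLp
open scoped ContDiff NNReal ENNReal InnerProductSpace RealInnerProductSpace Laplacian

namespace Literature.Analysis.FluidPDE

open Literature.Analysis.FunctionSpaces

/-- The Sobolev norm of `-f` is at most that of `f` (post-composition with `-id`), for `f` smooth
on the open set. [folklore] -/
theorem eSobolevDomainNorm_neg_le {Ω : TopologicalSpace.Opens (EuclideanSpace ℝ (Fin 3))} (k : ℕ)
    (p : ℝ≥0∞) {f : (EuclideanSpace ℝ (Fin 3)) → ℝ} (hf : ContDiffOn ℝ ∞ f Ω) :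
    eSobolevDomainNorm k p Ω volume (fun x => -f x) ≤ eSobolevDomainNorm k p Ω volume f := by
  have h := eSobolevDomainNorm_clm_comp_le (μ := volume) (Ω := Ω) (p := p)
    (-(ContinuousLinearMap.id ℝ ℝ)) k hf
  have hn : ‖-(ContinuousLinearMap.id ℝ ℝ)‖₊ ≤ 1 := by
    rw [nnnorm_neg, ← NNReal.coe_le_coe, coe_nnnorm, NNReal.coe_one]
    exact ContinuousLinearMap.norm_id_le
  calc eSobolevDomainNorm k p Ω volume (fun x => -f x)
      = eSobolevDomainNorm k p Ω volume (fun x => (-(ContinuousLinearMap.id ℝ ℝ)) (f x)) := rfl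
    _ ≤ ‖-(ContinuousLinearMap.id ℝ ℝ)‖₊ * eSobolevDomainNorm k p Ω volume f := h
    _ ≤ 1 * eSobolevDomainNorm k p Ω volume f := by gcongr; exact_mod_cast hn
    _ = eSobolevDomainNorm k p Ω volume f := one_mul _

/-- **Ferrari's Lemma 2 in the periodic cylinder from the standard Neumann estimate**
(`Ferrari1993_periodicCylinderPressureEstimate`, Ferrari 1993, Lemma 2 pp. 280–281:
`|∇p|_{H^s} ≤ C |u|_{W^{1,∞}} |u|_{H^s}` for solutions of (1)–(3), `s = 3`). The hypothesis is the
"standard estimate of `∇p`" of p. 281 with the Trace theorem applied and the boundary norm of p. 278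
(defined through extensions): for `L > 0` there is `C` such that for all `q`, `G` of class `C^∞` on
the closed cylinder `{r ≤ 1}` and `L`-periodic in `z` with `D q|_{{r ≤ 1}}(x)(e_r(x)) = G(x)` on the
wall `{r = 1}`, `‖∇q‖_{H³(cell)} ≤ C(‖Δq‖_{H²(cell)} + ‖G‖_{H³(cell)})` (norms
`eSobolevDomainNorm k 2 (cylinderCell L) volume`, Mathlib's `gradient` and Laplacian on the open
cell; Taylor, *PDE I*, Ch. 5 §7 (7.37) with Props. 7.5–7.7 and Ch. 4 §4 Prop. 4.5 on the compact flat
manifold with boundary `{r ≤ 1} × ℝ/Lℤ`). Proof: the Neumann problem (10)–(12) of the pressure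
(`cylLap_pressure_eq`, `neumann_pressure_eq`), the data estimates
(`exists_eSobolevDomainNorm_two_coord_fderivWithin_mul_le`, `exists_eSobolevDomainNorm_three_coord_sq_le`),
and `tr(T ∘ T) = Σᵢⱼ ℓⱼ(Teᵢ)ℓᵢ(Teⱼ)`; constant `C_N (9C₁ + 2C₂)`. [cite: Ferrari1993, Lemma 2 and its proof, pp. 280–281] -/
theorem Ferrari1993_periodicCylinderPressureEstimate_of_neumannEstimate
    (hN : ∀ (L : ℝ), 0 < L → ∃ C : ℝ≥0, ∀ (q G : (EuclideanSpace ℝ (Fin 3)) → ℝ),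
      ContDiffOn ℝ ∞ q (closure (unitCylinder : Set (EuclideanSpace ℝ (Fin 3)))) →
      ContDiffOn ℝ ∞ G (closure (unitCylinder : Set (EuclideanSpace ℝ (Fin 3)))) →
      IsAxiallyPeriodic L q → IsAxiallyPeriodic L G →
      (∀ x ∈ frontier (unitCylinder : Set (EuclideanSpace ℝ (Fin 3))),
        fderivWithin ℝ q (closure (unitCylinder : Set (EuclideanSpace ℝ (Fin 3)))) x (eR x) = G x) →
      eSobolevDomainNorm 3 2 (cylinderCell L) volume (gradient q) ≤
        C * (eSobolevDomainNorm 2 2 (cylinderCell L) volume (Δ q) +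
          eSobolevDomainNorm 3 2 (cylinderCell L) volume G)) :
    Ferrari1993_periodicCylinderPressureEstimate := by
  intro L hL
  obtain ⟨CN, hCN⟩ := hN L hL
  obtain ⟨C₁, hC₁⟩ := exists_eSobolevDomainNorm_two_coord_fderivWithin_mul_le hL
  obtain ⟨C₂, hC₂⟩ := exists_eSobolevDomainNorm_three_coord_sq_le hL
  refine ⟨CN * (9 * C₁ + 2 * C₂), ?_⟩
  intro u₀ T hT u p hsol t ht
  -- notation
  set ι := Fin (Module.finrank ℝ (EuclideanSpace ℝ (Fin 3))) with hι
  set b : Module.Basis ι ℝ (EuclideanSpace ℝ (Fin 3)) := Module.finBasis ℝ (EuclideanSpace ℝ (Fin 3))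
    with hb
  set K : Set (EuclideanSpace ℝ (Fin 3)) := closure (unitCylinder : Set (EuclideanSpace ℝ (Fin 3)))
    with hK_def
  set Ω : Set (EuclideanSpace ℝ (Fin 3)) := (cylinderCell L : Set (EuclideanSpace ℝ (Fin 3))) with hΩ_def
  have hU : IsOpen (unitCylinder : Set (EuclideanSpace ℝ (Fin 3))) := unitCylinder.isOpen
  have hΩU : Ω ⊆ (unitCylinder : Set (EuclideanSpace ℝ (Fin 3))) := cylinderCell_le_unitCylinder L
  have hKu : UniqueDiffOn ℝ K := uniqueDiffOn_closure_unitCylinder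
  set S : ℝ≥0∞ := eSobolevDomainNorm 1 ∞ (cylinderCell L) volume (u t) with hS
  set N : ℝ≥0∞ := eSobolevDomainNorm 3 2 (cylinderCell L) volume (u t) with hN_def
  -- the slices and the Neumann datum
  have hus : ContDiffOn ℝ ∞ (u t) K := contDiffOn_slice_of_contDiffOn_uncurry hsol.smooth_velocity ht
  have hps : ContDiffOn ℝ ∞ (p t) K := contDiffOn_slice_of_contDiffOn_uncurry hsol.smooth_pressure ht
  have huper : IsAxiallyPeriodic L (u t) := (hsol.periodic t ht).1
  have hpper : IsAxiallyPeriodic L (p t) := (hsol.periodic t ht).2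
  set G : (EuclideanSpace ℝ (Fin 3)) → ℝ := fun y => u t y 0 ^ 2 + u t y 1 ^ 2 with hG_def
  obtain ⟨hGs, hGper⟩ := hsol.contDiffOn_neumannDatum ht
  have hneu : ∀ x ∈ frontier (unitCylinder : Set (EuclideanSpace ℝ (Fin 3))),
      fderivWithin ℝ (p t) K x (eR x) = G x := fun x hx => hsol.neumann_pressure_eq ht hx
  have key := hCN (p t) G hps hGs hpper hGper hneu
  -- the Laplacian of the pressure on the cell, in coordinates
  set DK : (EuclideanSpace ℝ (Fin 3)) → (EuclideanSpace ℝ (Fin 3)) →L[ℝ] (EuclideanSpace ℝ (Fin 3)) :=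
    fun x => fderivWithin ℝ (u t) K x with hDK
  set F : ι → ι → (EuclideanSpace ℝ (Fin 3)) → ℝ := fun i j x =>
    b.coord j (DK x (b i)) * b.coord i (DK x (b j)) with hF
  have hΔ_eq : EqOn (Δ (p t)) (fun x => -∑ i, ∑ j, F i j x) Ω := by
    intro x hx
    have hxU := hΩU hx
    rw [laplacian_eq_cylLap hps hxU, hsol.cylLap_pressure_eq ht (subset_closure hxU),
      ContinuousLinearMap.toLinearMap_comp, trace_comp_self_eq_sum_coord b]
    simp only [hF, hDK, ContinuousLinearMap.coe_coe]
    rfl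
  -- smoothness of the summands on the cell
  have hDKs : ContDiffOn ℝ ∞ DK K := hus.fderivWithin hKu (by simp)
  have hDKi : ∀ i, ContDiffOn ℝ ∞ (fun x => DK x (b i)) K := fun i => hDKs.clm_apply contDiffOn_const
  have hFs : ∀ i j, ContDiffOn ℝ ∞ (F i j) (cylinderCell L) := by
    intro i j
    have h1 : ContDiffOn ℝ ∞ (fun x => b.coord j (DK x (b i))) K :=
      (LinearMap.toContinuousLinearMap (b.coord j)).contDiff.comp_contDiffOn (hDKi i)
    have h2 : ContDiffOn ℝ ∞ (fun x => b.coord i (DK x (b j))) K :=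
      (LinearMap.toContinuousLinearMap (b.coord i)).contDiff.comp_contDiffOn (hDKi j)
    exact (h1.mul h2).mono (subset_closure.trans (closure_cylinderCell_subset L))
  have hFm : ∀ i j, AEStronglyMeasurable (F i j) (volume.restrict Ω) := fun i j =>
    ((hFs i j).continuousOn).aestronglyMeasurable (cylinderCell L).isOpen.measurableSet
  -- `‖Δp‖_{H²(cell)} ≤ 9 C₁ S N`
  have hF_le : ∀ i j, eSobolevDomainNorm 2 2 (cylinderCell L) volume (F i j) ≤ C₁ * S * N :=
    fun i j => hC₁ (u t) hus huper i j j i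
  have hcard : (Finset.univ : Finset ι).card = 3 := by
    simp only [Finset.card_univ, hι, Fintype.card_fin, finrank_euclideanSpace_fin]
  have hΔ : eSobolevDomainNorm 2 2 (cylinderCell L) volume (Δ (p t)) ≤ 9 * C₁ * S * N := by
    rw [SobolevApprox.eSobolevDomainNorm_congr hΔ_eq]
    have hsum_smooth : ContDiffOn ℝ ∞ (fun x => ∑ i, ∑ j, F i j x) (cylinderCell L) :=
      ContDiffOn.sum fun i _ => ContDiffOn.sum fun j _ => hFs i j
    refine (eSobolevDomainNorm_neg_le 2 2 hsum_smooth).trans ?_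
    have e1 : (fun x => ∑ i, ∑ j, F i j x) = ∑ i, ∑ j, F i j := by
      funext x
      simp only [Finset.sum_apply]
    rw [e1]
    calc eSobolevDomainNorm 2 2 (cylinderCell L) volume (∑ i, ∑ j, F i j)
        ≤ ∑ i, eSobolevDomainNorm 2 2 (cylinderCell L) volume (∑ j, F i j) :=
          SobolevApprox.eSobolevDomainNorm_sum_le _
            (fun i _ => Finset.aestronglyMeasurable_sum _ fun j _ => hFm i j) (by norm_num)
      _ ≤ ∑ i, ∑ j, eSobolevDomainNorm 2 2 (cylinderCell L) volume (F i j) :=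
          Finset.sum_le_sum fun i _ =>
            SobolevApprox.eSobolevDomainNorm_sum_le _ (fun j _ => hFm i j) (by norm_num)
      _ ≤ ∑ _i : ι, ∑ _j : ι, (C₁ : ℝ≥0∞) * S * N :=
          Finset.sum_le_sum fun i _ => Finset.sum_le_sum fun j _ => hF_le i j
      _ = 9 * C₁ * S * N := by
          rw [Finset.sum_const, Finset.sum_const, hcard]
          simp only [nsmul_eq_mul]
          push_cast
          ring
  -- `‖G‖_{H³(cell)} ≤ 2 C₂ S N`
  have hG : eSobolevDomainNorm 3 2 (cylinderCell L) volume G ≤ 2 * C₂ * S * N := by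
    have hsq : ∀ k : Fin 3, eSobolevDomainNorm 3 2 (cylinderCell L) volume (fun x => u t x k ^ 2) ≤
        C₂ * S * N := fun k => hC₂ (u t) hus huper k
    have hsqm : ∀ k : Fin 3, AEStronglyMeasurable (fun x => u t x k ^ 2) (volume.restrict Ω) := by
      intro k
      have hc : ContinuousOn (fun x => u t x k ^ 2) (unitCylinder : Set (EuclideanSpace ℝ (Fin 3))) :=
        (((EuclideanSpace.proj (𝕜 := ℝ) k).continuous.comp_continuousOn
          (hus.continuousOn.mono subset_closure)).pow 2)
      exact aestronglyMeasurable_cylinderCell_of_continuousOn L hc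
    have e1 : G = ∑ k ∈ ({0, 1} : Finset (Fin 3)), fun x => u t x k ^ 2 := by
      funext x
      rw [Finset.sum_apply, Finset.sum_pair (by decide)]
    rw [e1]
    calc eSobolevDomainNorm 3 2 (cylinderCell L) volume (∑ k ∈ ({0, 1} : Finset (Fin 3)), fun x => u t x k ^ 2)
        ≤ ∑ k ∈ ({0, 1} : Finset (Fin 3)), eSobolevDomainNorm 3 2 (cylinderCell L) volume (fun x => u t x k ^ 2) :=
          SobolevApprox.eSobolevDomainNorm_sum_le _ (fun k _ => hsqm k) (by norm_num)
      _ ≤ ∑ _k ∈ ({0, 1} : Finset (Fin 3)), (C₂ : ℝ≥0∞) * S * N := Finset.sum_le_sum fun k _ => hsq k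
      _ = 2 * C₂ * S * N := by
          rw [Finset.sum_pair (by decide)]
          ring
  -- assemble
  calc eSobolevDomainNorm 3 2 (cylinderCell L) volume (gradient (p t))
      ≤ CN * (eSobolevDomainNorm 2 2 (cylinderCell L) volume (Δ (p t)) +
          eSobolevDomainNorm 3 2 (cylinderCell L) volume G) := key
    _ ≤ CN * (9 * C₁ * S * N + 2 * C₂ * S * N) := by gcongr
    _ = ((CN * (9 * C₁ + 2 * C₂) : ℝ≥0) : ℝ≥0∞) * S * N := by push_cast; ring

end Literature.Analysis.FluidPDE
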